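import Summits.AtomisticToContinuum.Crystallization.Theorems.ExcessDecayLiouvilleSiteGeometry
import Summits.AtomisticToContinuum.Crystallization.Theorems.ExcessDecayLiouvilleHcpLiouvilleDefs

/-!
# `ExcessDecayLiouville.HcpLiouville` (stmt-AtomisticToContinuum-9332), line `Sketch`: the path bound for period differences

Step (5) of stub `stub_flatDifferences` (level 2 of the two-level Caccioppoli argument): the hypothesis
`GrowthBound t A v` (`Σ_{p ∈ S ∩ B_R(c)} Σ_{q ∼ p} ‖v p − v q‖² ≤ C·R` over nearest-neighbour bonds
`dist p q ≤ 11/10` of the site set `S = Sites₀ t A`) controls every PERIOD DIFFERENCE `v(· + Az) − v`,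
`z ∈ Λ₀`, in `ℓ²` of balls with the same linear growth:

* `flatDiff_pathBound_of_growthBound` : `∃ C_z, ∀ c, ∀ R ≥ 1, Σ_{p ∈ U} ‖v(p + Az) − v p‖² ≤ C_z·R` for every
  finite set `U` of sites in `B_R(c)`.

Proof: the set of `z ∈ Λ₀` with this property is a subgroup (translate the centre; `(a+b)² ≤ 2a² + 2b²`)
containing the generators `u, v` (the bond `p ∼ p + Ae` has length `‖Ae‖ ≤ 199/200`) and the layer period
`c = 2√(2/3)e₃` (two bonds through the other sublattice, `t 0 + Aζ ∼ t 1 + Aζ ∼ t 0 + A(ζ + c)`, of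
length `≤ 199/200 + 1/40` under `Inner₀`).  All `[folklore]`; a `--supports` helper for item
stmt-AtomisticToContinuum-9332, nothing here closes an item.
-/

noncomputable section

namespace Summit.AtomisticToContinuum.Crystallization.Theorems.ExcessDecayLiouville

open scoped BigOperators Topology Classical InnerProductSpace
open Literature.MathematicalPhysics.StatisticalMechanics
open Summit.AtomisticToContinuum.Crystallization.Theses.ExcessDecayLiouville
open Summit.AtomisticToContinuum.Crystallization.Theorems.PhononStabilityNegative

/-! ## Bookkeeping -/

/-- The site set is stable under `+A Λ₀` (local copy). [folklore] -/
private theorem add_mem_sites₀'' {t : Fin 2 → (EuclideanSpace ℝ (Fin 3))} {A : (EuclideanSpace ℝ (Fin 3)) →L[ℝ] (EuclideanSpace ℝ (Fin 3))} {p e : (EuclideanSpace ℝ (Fin 3))}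
    (hp : p ∈ Sites₀ t A) (he : e ∈ Λ₀) : p + A e ∈ Sites₀ t A := by
  obtain ⟨m, z, hz, rfl⟩ := hp
  exact ⟨m, z + e, hcpLiouvilleLam_add_mem hz he, by rw [map_add, add_assoc]⟩

/-- The site set is stable under `−A Λ₀` (local copy). [folklore] -/
private theorem sub_mem_sites₀'' {t : Fin 2 → (EuclideanSpace ℝ (Fin 3))} {A : (EuclideanSpace ℝ (Fin 3)) →L[ℝ] (EuclideanSpace ℝ (Fin 3))} {p e : (EuclideanSpace ℝ (Fin 3))}
    (hp : p ∈ Sites₀ t A) (he : e ∈ Λ₀) : p - A e ∈ Sites₀ t A := by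
  obtain ⟨m, z, hz, rfl⟩ := hp
  exact ⟨m, z - e, hcpLiouvilleLam_sub_mem hz he, by rw [map_sub, add_sub_assoc]⟩

/-- `‖x + y‖² ≤ 2‖x‖² + 2‖y‖²`. [folklore] -/
private theorem norm_add_sq_le_two (x y : (EuclideanSpace ℝ (Fin 3))) : ‖x + y‖ ^ 2 ≤ 2 * ‖x‖ ^ 2 + 2 * ‖y‖ ^ 2 := by
  have h := parallelogram_law_with_norm ℝ x y
  nlinarith [sq_nonneg ‖x - y‖]

/-! ## From the growth bound to finite sums over balls -/

/-- One nearest-neighbour bond is dominated by the nearest-neighbour strain at its base point.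
[folklore] -/
private theorem sq_le_nnRow {t : Fin 2 → (EuclideanSpace ℝ (Fin 3))} {A : (EuclideanSpace ℝ (Fin 3)) →L[ℝ] (EuclideanSpace ℝ (Fin 3))} (hA : Adm₀ A) (hI : Inner₀ t A)
    (v : (EuclideanSpace ℝ (Fin 3)) → (EuclideanSpace ℝ (Fin 3))) (p : (EuclideanSpace ℝ (Fin 3))) (q₀ : Sites₀ t A) (hd : dist p q₀ ≤ 11 / 10) :
    ‖v p - v q₀‖ ^ 2 ≤
      ∑' q : Sites₀ t A, (if dist p q ≤ 11 / 10 then ‖v p - v q‖ ^ 2 else 0) := by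
  have hfin := finite_sites_dist_le hA hI p (11 / 10)
  have hsupp : ∀ q : Sites₀ t A, q ∉ (hfin.preimage Subtype.val_injective.injOn).toFinset →
      (if dist p q ≤ 11 / 10 then ‖v p - v q‖ ^ 2 else 0) = 0 := by
    intro q hq
    rw [if_neg]
    intro hle
    apply hq
    simp only [Set.Finite.mem_toFinset, Set.mem_preimage, Set.mem_setOf_eq]
    exact ⟨q.2, by rwa [dist_comm]⟩
  have hs : Summable fun q : Sites₀ t A => (if dist p q ≤ 11 / 10 then ‖v p - v q‖ ^ 2 else 0) :=
    summable_of_ne_finset_zero hsupp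
  have h := hs.le_tsum q₀ (fun q _ => by positivity)
  rwa [if_pos hd] at h

/-- **The growth bound on finite sets of sites.** [folklore] -/
private theorem sum_nnRow_le {t : Fin 2 → (EuclideanSpace ℝ (Fin 3))} {A : (EuclideanSpace ℝ (Fin 3)) →L[ℝ] (EuclideanSpace ℝ (Fin 3))} (hA : Adm₀ A) (hI : Inner₀ t A)
    (v : (EuclideanSpace ℝ (Fin 3)) → (EuclideanSpace ℝ (Fin 3))) {C : ℝ} {c : (EuclideanSpace ℝ (Fin 3))} {R : ℝ}
    (hC : (∑' p : {s : (EuclideanSpace ℝ (Fin 3)) // s ∈ Sites₀ t A ∧ dist s c ≤ R}, ∑' q : Sites₀ t A,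
      if dist (p : (EuclideanSpace ℝ (Fin 3))) q ≤ 11 / 10 then ‖v p - v q‖ ^ 2 else 0) ≤ C * R)
    (U : Finset (Sites₀ t A)) (hU : ∀ p ∈ U, dist (p : (EuclideanSpace ℝ (Fin 3))) c ≤ R) :
    ∑ p ∈ U, (∑' q : Sites₀ t A, if dist (p : (EuclideanSpace ℝ (Fin 3))) q ≤ 11 / 10 then ‖v p - v q‖ ^ 2 else 0) ≤ C * R := by
  haveI : Finite {s : (EuclideanSpace ℝ (Fin 3)) // s ∈ Sites₀ t A ∧ dist s c ≤ R} := (finite_sites_dist_le hA hI c R).to_subtype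
  set G : (EuclideanSpace ℝ (Fin 3)) → ℝ := fun p => ∑' q : Sites₀ t A, if dist p q ≤ 11 / 10 then ‖v p - v q‖ ^ 2 else 0
    with hG
  have hG0 : ∀ p, 0 ≤ G p := fun p => tsum_nonneg fun q => by positivity
  -- embed `U` into the ball subtype
  let j : {p // p ∈ U} → {s : (EuclideanSpace ℝ (Fin 3)) // s ∈ Sites₀ t A ∧ dist s c ≤ R} :=
    fun p => ⟨p.1.1, p.1.2, hU p.1 p.2⟩
  have hj : Function.Injective j := by
    intro a b h
    have : (a.1 : (EuclideanSpace ℝ (Fin 3))) = b.1 := congrArg (fun x : {s : (EuclideanSpace ℝ (Fin 3)) // s ∈ Sites₀ t A ∧ dist s c ≤ R} => x.1) h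
    exact Subtype.ext (Subtype.ext this)
  have hsum : ∑ p ∈ U, G p = ∑ x ∈ U.attach.map ⟨j, hj⟩, G x := by
    rw [Finset.sum_map, ← Finset.sum_attach U]
    rfl
  refine le_trans ?_ hC
  show ∑ p ∈ U, G p ≤ ∑' x : {s : (EuclideanSpace ℝ (Fin 3)) // s ∈ Sites₀ t A ∧ dist s c ≤ R}, G x
  rw [hsum]
  exact (Summable.of_finite).sum_le_tsum _ (fun x _ => hG0 x)

/-! ## The path property and its closure properties -/

/-- The growth constant of a `GrowthBound` may be taken nonnegative, in finite-sum form. [folklore] -/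
private theorem growth_finset {t : Fin 2 → (EuclideanSpace ℝ (Fin 3))} {A : (EuclideanSpace ℝ (Fin 3)) →L[ℝ] (EuclideanSpace ℝ (Fin 3))} (hA : Adm₀ A) (hI : Inner₀ t A)
    {v : (EuclideanSpace ℝ (Fin 3)) → (EuclideanSpace ℝ (Fin 3))} (hG : GrowthBound t A v) :
    ∃ C : ℝ, 0 ≤ C ∧ ∀ (c : (EuclideanSpace ℝ (Fin 3))) (R : ℝ), 1 ≤ R → ∀ U : Finset (Sites₀ t A),
      (∀ p ∈ U, dist (p : (EuclideanSpace ℝ (Fin 3))) c ≤ R) →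
        ∑ p ∈ U, (∑' q : Sites₀ t A, if dist (p : (EuclideanSpace ℝ (Fin 3))) q ≤ 11 / 10 then ‖v p - v q‖ ^ 2 else 0) ≤ C * R := by
  obtain ⟨C, hC⟩ := hG
  refine ⟨C, ?_, fun c R hR U hU => sum_nnRow_le hA hI v (hC c R hR) U hU⟩
  have h := hC 0 1 le_rfl
  rw [mul_one] at h
  exact le_trans (tsum_nonneg fun _ => tsum_nonneg fun _ => by positivity) h

/-- A generator step: if every site `p` has a site within `11/10` of both `p` and `p + Ae`, then the
period difference along `e` obeys the path bound. [folklore] -/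
private theorem path_of_twoStep {t : Fin 2 → (EuclideanSpace ℝ (Fin 3))} {A : (EuclideanSpace ℝ (Fin 3)) →L[ℝ] (EuclideanSpace ℝ (Fin 3))} (hA : Adm₀ A) (hI : Inner₀ t A)
    {v : (EuclideanSpace ℝ (Fin 3)) → (EuclideanSpace ℝ (Fin 3))} (hG : GrowthBound t A v) {e : (EuclideanSpace ℝ (Fin 3))} (he : e ∈ Λ₀) (hAe : ‖A e‖ ≤ 2)
    (hmid : ∀ p ∈ Sites₀ t A, ∃ m : Sites₀ t A, dist p m ≤ 11 / 10 ∧ dist (p + A e) m ≤ 11 / 10) :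
    ∃ C : ℝ, ∀ (c : (EuclideanSpace ℝ (Fin 3))) (R : ℝ), 1 ≤ R → ∀ U : Finset (Sites₀ t A),
      (∀ p ∈ U, dist (p : (EuclideanSpace ℝ (Fin 3))) c ≤ R) → ∑ p ∈ U, ‖v (p + A e) - v p‖ ^ 2 ≤ C * R := by
  obtain ⟨C, hC0, hC⟩ := growth_finset hA hI hG
  refine ⟨8 * C, fun c R hR U hU => ?_⟩
  set G : (EuclideanSpace ℝ (Fin 3)) → ℝ := fun p => ∑' q : Sites₀ t A, if dist p q ≤ 11 / 10 then ‖v p - v q‖ ^ 2 else 0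
    with hGdef
  -- pointwise two-step bound
  have hpt : ∀ p ∈ U, ‖v (p + A e) - v p‖ ^ 2 ≤ 2 * G (p + A e) + 2 * G p := by
    intro p _
    obtain ⟨m, hm1, hm2⟩ := hmid p p.2
    have h1 : ‖v ((p : (EuclideanSpace ℝ (Fin 3))) + A e) - v m‖ ^ 2 ≤ G (p + A e) := sq_le_nnRow hA hI v _ m hm2
    have h2 : ‖v (p : (EuclideanSpace ℝ (Fin 3))) - v m‖ ^ 2 ≤ G p := sq_le_nnRow hA hI v _ m hm1
    have hsplit : v ((p : (EuclideanSpace ℝ (Fin 3))) + A e) - v p = (v ((p : (EuclideanSpace ℝ (Fin 3))) + A e) - v m) + -(v (p : (EuclideanSpace ℝ (Fin 3))) - v m) := by abel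
    rw [hsplit]
    refine (norm_add_sq_le_two _ _).trans ?_
    rw [norm_neg]
    linarith
  -- the translated finite set
  let emb : Sites₀ t A ↪ Sites₀ t A :=
    ⟨fun p => ⟨p + A e, add_mem_sites₀'' p.2 he⟩, fun a b h => Subtype.ext (add_right_cancel
      (congrArg Subtype.val h))⟩
  have hU' : ∀ p ∈ U.map emb, dist (p : (EuclideanSpace ℝ (Fin 3))) c ≤ R + 2 := by
    intro p hp
    rw [Finset.mem_map] at hp
    obtain ⟨p₀, hp₀, rfl⟩ := hp
    show dist ((p₀ : (EuclideanSpace ℝ (Fin 3))) + A e) c ≤ R + 2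
    calc dist ((p₀ : (EuclideanSpace ℝ (Fin 3))) + A e) c ≤ dist ((p₀ : (EuclideanSpace ℝ (Fin 3))) + A e) p₀ + dist (p₀ : (EuclideanSpace ℝ (Fin 3))) c := dist_triangle _ _ _
      _ ≤ 2 + R := by
          rw [dist_eq_norm, add_sub_cancel_left]
          exact add_le_add hAe (hU p₀ hp₀)
      _ = R + 2 := by ring
  have h1 : ∑ p ∈ U, G (p + A e) ≤ C * (R + 2) := by
    have h := hC c (R + 2) (by linarith) (U.map emb) hU'
    rw [Finset.sum_map] at h
    exact h
  have h2 : ∑ p ∈ U, G p ≤ C * R := hC c R hR U hU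
  calc ∑ p ∈ U, ‖v (p + A e) - v p‖ ^ 2 ≤ ∑ p ∈ U, (2 * G (p + A e) + 2 * G p) := Finset.sum_le_sum hpt
    _ = 2 * ∑ p ∈ U, G (p + A e) + 2 * ∑ p ∈ U, G p := by
        rw [Finset.sum_add_distrib, Finset.mul_sum, Finset.mul_sum]
    _ ≤ 2 * (C * (R + 2)) + 2 * (C * R) := by gcongr
    _ ≤ 8 * C * R := by nlinarith

/-! ## Geometry of the generators -/

/-- `‖v‖ = 1` for `v = triangularVec₂ 1`. [folklore] -/
private theorem norm_triangularVec₂' : ‖(triangularVec₂ 1 : (EuclideanSpace ℝ (Fin 3)))‖ = 1 := by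
  have h := hcpLiouvilleLam_norm_sq 0 1 0
  simp only [Int.cast_zero, zero_smul, Int.cast_one, one_smul, zero_add, add_zero] at h
  have hn : 0 ≤ ‖(triangularVec₂ 1 : (EuclideanSpace ℝ (Fin 3)))‖ := norm_nonneg _
  nlinarith [h, hn]

/-- `‖c‖² = 8/3` for the layer period `c = 2√(2/3)e₃`, hence `‖A c‖ ≤ 2`. [folklore] -/
private theorem norm_apply_layerPeriod_le {A : (EuclideanSpace ℝ (Fin 3)) →L[ℝ] (EuclideanSpace ℝ (Fin 3))} (hA : Adm₀ A) :
    ‖A (layerNormal (2 * Real.sqrt (2 / 3)))‖ ≤ 2 := by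
  have h := hcpLiouvilleLam_norm_sq 0 0 1
  simp only [Int.cast_zero, zero_smul, Int.cast_one, one_smul, zero_add] at h
  have hn : 0 ≤ ‖(layerNormal (2 * Real.sqrt (2 / 3)) : (EuclideanSpace ℝ (Fin 3)))‖ := norm_nonneg _
  have hc : ‖(layerNormal (2 * Real.sqrt (2 / 3)) : (EuclideanSpace ℝ (Fin 3)))‖ ≤ 2 := by nlinarith [h, hn]
  have := norm_apply_le_of_adm₀ hA (layerNormal (2 * Real.sqrt (2 / 3)))
  nlinarith

/-- The hcp motif vector `w₀ + √(2/3)e₃` is a unit vector. [folklore] -/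
private theorem norm_motif_eq_one' : ‖(barlowOffset 1 + layerNormal (Real.sqrt (2 / 3)) : (EuclideanSpace ℝ (Fin 3)))‖ = 1 := by
  have h : ‖(barlowOffset 1 + layerNormal (Real.sqrt (2 / 3)) : (EuclideanSpace ℝ (Fin 3)))‖ ^ 2 = 1 := by
    rw [EuclideanSpace.norm_eq, Real.sq_sqrt (by positivity), Fin.sum_univ_three]
    simp [barlowOffset, layerNormal, Real.norm_eq_abs, sq_abs, div_pow,
      Real.sq_sqrt (show (0:ℝ) ≤ 3 by norm_num)]
    norm_num
  nlinarith [norm_nonneg (barlowOffset 1 + layerNormal (Real.sqrt (2 / 3)) : (EuclideanSpace ℝ (Fin 3)))]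

/-- `c − (w₀ + √(2/3)e₃)` is a unit vector. [folklore] -/
private theorem norm_layerPeriod_sub_motif' :
    ‖(layerNormal (2 * Real.sqrt (2 / 3)) - (barlowOffset 1 + layerNormal (Real.sqrt (2 / 3))) : (EuclideanSpace ℝ (Fin 3)))‖
      = 1 := by
  have h : ‖(layerNormal (2 * Real.sqrt (2 / 3)) -
      (barlowOffset 1 + layerNormal (Real.sqrt (2 / 3))) : (EuclideanSpace ℝ (Fin 3)))‖ ^ 2 = 1 := by
    rw [EuclideanSpace.norm_eq, Real.sq_sqrt (by positivity), Fin.sum_univ_three]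
    simp [barlowOffset, layerNormal, Real.norm_eq_abs, sq_abs, div_pow,
      Real.sq_sqrt (show (0:ℝ) ≤ 3 by norm_num)]
    have s23 : (Real.sqrt (2 / 3)) ^ 2 = 2 / 3 := Real.sq_sqrt (by norm_num)
    have hq : (Real.sqrt 2 / Real.sqrt 3 : ℝ) ^ 2 = 2 / 3 := by
      rw [div_pow, Real.sq_sqrt (by norm_num), Real.sq_sqrt (by norm_num)]
    nlinarith [s23, hq]
  nlinarith [norm_nonneg
    (layerNormal (2 * Real.sqrt (2 / 3)) - (barlowOffset 1 + layerNormal (Real.sqrt (2 / 3))) : (EuclideanSpace ℝ (Fin 3)))]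

/-- The bond `t 0 + Aζ ∼ t 1 + Aζ` has length `≤ 11/10`. [folklore] -/
private theorem dist_cross_le' {t : Fin 2 → (EuclideanSpace ℝ (Fin 3))} {A : (EuclideanSpace ℝ (Fin 3)) →L[ℝ] (EuclideanSpace ℝ (Fin 3))} (hA : Adm₀ A) (hI : Inner₀ t A)
    (ζ : (EuclideanSpace ℝ (Fin 3))) : dist (t 0 + A ζ) (t 1 + A ζ) ≤ 11 / 10 := by
  have h1 : ‖A (barlowOffset 1 + layerNormal (Real.sqrt (2 / 3)))‖ ≤ 199 / 200 := by
    have := norm_apply_le_of_adm₀ hA (barlowOffset 1 + layerNormal (Real.sqrt (2 / 3)))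
    rwa [norm_motif_eq_one', mul_one] at this
  have h2 : ‖t 1 - t 0 - A (barlowOffset 1 + layerNormal (Real.sqrt (2 / 3)))‖ ≤ 1 / 40 := hI
  have h3 := norm_sub_norm_le (t 1 - t 0) (A (barlowOffset 1 + layerNormal (Real.sqrt (2 / 3))))
  rw [dist_eq_norm, add_sub_add_right_eq_sub, norm_sub_rev]
  linarith

/-- The bond `t 1 + Aζ ∼ t 0 + A(ζ + c)` has length `≤ 11/10`. [folklore] -/
private theorem dist_cross'_le' {t : Fin 2 → (EuclideanSpace ℝ (Fin 3))} {A : (EuclideanSpace ℝ (Fin 3)) →L[ℝ] (EuclideanSpace ℝ (Fin 3))} (hA : Adm₀ A) (hI : Inner₀ t A)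
    (ζ : (EuclideanSpace ℝ (Fin 3))) : dist (t 1 + A ζ) (t 0 + A (ζ + layerNormal (2 * Real.sqrt (2 / 3)))) ≤ 11 / 10 := by
  have h1 : ‖A (layerNormal (2 * Real.sqrt (2 / 3)) -
      (barlowOffset 1 + layerNormal (Real.sqrt (2 / 3))))‖ ≤ 199 / 200 := by
    have := norm_apply_le_of_adm₀ hA
      (layerNormal (2 * Real.sqrt (2 / 3)) - (barlowOffset 1 + layerNormal (Real.sqrt (2 / 3))))
    rwa [norm_layerPeriod_sub_motif', mul_one] at this
  have h2 : ‖t 1 - t 0 - A (barlowOffset 1 + layerNormal (Real.sqrt (2 / 3)))‖ ≤ 1 / 40 := hI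
  have hsplit : t 1 + A ζ - (t 0 + A (ζ + layerNormal (2 * Real.sqrt (2 / 3)))) =
      (t 1 - t 0 - A (barlowOffset 1 + layerNormal (Real.sqrt (2 / 3)))) -
        A (layerNormal (2 * Real.sqrt (2 / 3)) - (barlowOffset 1 + layerNormal (Real.sqrt (2 / 3)))) := by
    rw [map_add, map_sub]; abel
  rw [dist_eq_norm, hsplit]
  have h3 := norm_sub_le (t 1 - t 0 - A (barlowOffset 1 + layerNormal (Real.sqrt (2 / 3))))
    (A (layerNormal (2 * Real.sqrt (2 / 3)) - (barlowOffset 1 + layerNormal (Real.sqrt (2 / 3)))))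
  linarith

/-- For a generator `e` with `‖e‖ = 1` the trivial intermediate site `p` itself works. [folklore] -/
private theorem mid_of_norm_eq_one {t : Fin 2 → (EuclideanSpace ℝ (Fin 3))} {A : (EuclideanSpace ℝ (Fin 3)) →L[ℝ] (EuclideanSpace ℝ (Fin 3))} (hA : Adm₀ A) {e : (EuclideanSpace ℝ (Fin 3))}
    (hne : ‖e‖ = 1) :
    ‖A e‖ ≤ 2 ∧ ∀ p ∈ Sites₀ t A, ∃ m : Sites₀ t A, dist p m ≤ 11 / 10 ∧ dist (p + A e) m ≤ 11 / 10 := by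
  have h1 : ‖A e‖ ≤ 199 / 200 := by
    have := norm_apply_le_of_adm₀ hA e
    rwa [hne, mul_one] at this
  refine ⟨by linarith, fun p hp => ⟨⟨p, hp⟩, ?_, ?_⟩⟩
  · show dist p p ≤ 11 / 10
    rw [dist_self]; norm_num
  · show dist (p + A e) p ≤ 11 / 10
    rw [dist_eq_norm, add_sub_cancel_left]
    linarith

/-- For the layer period `c` the other sublattice provides the intermediate site. [folklore] -/
private theorem mid_layerPeriod {t : Fin 2 → (EuclideanSpace ℝ (Fin 3))} {A : (EuclideanSpace ℝ (Fin 3)) →L[ℝ] (EuclideanSpace ℝ (Fin 3))} (hA : Adm₀ A) (hI : Inner₀ t A) :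
    ∀ p ∈ Sites₀ t A, ∃ m : Sites₀ t A, dist p m ≤ 11 / 10 ∧
      dist (p + A (layerNormal (2 * Real.sqrt (2 / 3)))) m ≤ 11 / 10 := by
  have hc : (layerNormal (2 * Real.sqrt (2 / 3)) : (EuclideanSpace ℝ (Fin 3))) ∈ Λ₀ := ⟨0, 0, 1, by simp⟩
  rintro p ⟨m, ζ, hζ, rfl⟩
  fin_cases m
  · refine ⟨⟨t 1 + A ζ, 1, ζ, hζ, rfl⟩, ?_, ?_⟩
    · exact dist_cross_le' hA hI ζ
    · show dist (t 0 + A ζ + A (layerNormal (2 * Real.sqrt (2 / 3)))) (t 1 + A ζ) ≤ 11 / 10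
      rw [add_assoc, ← map_add, dist_comm]
      exact dist_cross'_le' hA hI ζ
  · refine ⟨⟨t 0 + A (ζ + layerNormal (2 * Real.sqrt (2 / 3))), 0, _,
      hcpLiouvilleLam_add_mem hζ hc, rfl⟩, ?_, ?_⟩
    · exact dist_cross'_le' hA hI ζ
    · show dist (t 1 + A ζ + A (layerNormal (2 * Real.sqrt (2 / 3))))
        (t 0 + A (ζ + layerNormal (2 * Real.sqrt (2 / 3)))) ≤ 11 / 10
      rw [add_assoc, ← map_add, dist_comm]
      exact dist_cross_le' hA hI _

/-! ## The path bound -/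

/-- **Path bound for period differences.**  Under `Adm₀ A`, `Inner₀ t A` and `GrowthBound t A v`, for
every `z ∈ Λ₀` there is `C_z` with `Σ_{p ∈ U} ‖v(p + Az) − v p‖² ≤ C_z·R` for every `R ≥ 1`, every centre
`c` and every finite set `U` of sites in the closed ball `B_R(c)`. [folklore] -/
theorem flatDiff_pathBound_of_growthBound {t : Fin 2 → (EuclideanSpace ℝ (Fin 3))} {A : (EuclideanSpace ℝ (Fin 3)) →L[ℝ] (EuclideanSpace ℝ (Fin 3))} (hA : Adm₀ A) (hI : Inner₀ t A)
    {v : (EuclideanSpace ℝ (Fin 3)) → (EuclideanSpace ℝ (Fin 3))} (hG : GrowthBound t A v) {z : (EuclideanSpace ℝ (Fin 3))} (hz : z ∈ Λ₀) :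
    ∃ C : ℝ, ∀ (c : (EuclideanSpace ℝ (Fin 3))) (R : ℝ), 1 ≤ R → ∀ U : Finset (Sites₀ t A),
      (∀ p ∈ U, dist (p : (EuclideanSpace ℝ (Fin 3))) c ≤ R) → ∑ p ∈ U, ‖v (p + A z) - v p‖ ^ 2 ≤ C * R := by
  -- the lattice vectors with the path property form a subgroup
  let G : AddSubgroup (EuclideanSpace ℝ (Fin 3)) :=
    { carrier := {e | e ∈ Λ₀ ∧ ∃ C : ℝ, ∀ (c : (EuclideanSpace ℝ (Fin 3))) (R : ℝ), 1 ≤ R → ∀ U : Finset (Sites₀ t A),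
        (∀ p ∈ U, dist (p : (EuclideanSpace ℝ (Fin 3))) c ≤ R) → ∑ p ∈ U, ‖v (p + A e) - v p‖ ^ 2 ≤ C * R}
      add_mem' := by
        rintro a b ⟨ha, Ca, hCa⟩ ⟨hb, Cb, hCb⟩
        refine ⟨hcpLiouvilleLam_add_mem ha hb, 2 * Cb + 2 * Ca, fun c R hR U hU => ?_⟩
        let emb : Sites₀ t A ↪ Sites₀ t A :=
          ⟨fun p => ⟨p + A a, add_mem_sites₀'' p.2 ha⟩, fun x y h => Subtype.ext (add_right_cancel
            (congrArg Subtype.val h))⟩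
        have hU' : ∀ p ∈ U.map emb, dist (p : (EuclideanSpace ℝ (Fin 3))) (c + A a) ≤ R := by
          intro p hp
          rw [Finset.mem_map] at hp
          obtain ⟨p₀, hp₀, rfl⟩ := hp
          show dist ((p₀ : (EuclideanSpace ℝ (Fin 3))) + A a) (c + A a) ≤ R
          rw [dist_add_right]
          exact hU p₀ hp₀
        have h1 : ∑ p ∈ U, ‖v ((p : (EuclideanSpace ℝ (Fin 3))) + A a + A b) - v (p + A a)‖ ^ 2 ≤ Cb * R := by
          have h := hCb (c + A a) R hR (U.map emb) hU'
          rw [Finset.sum_map] at h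
          exact h
        have h2 := hCa c R hR U hU
        have hpt : ∀ p ∈ U, ‖v ((p : (EuclideanSpace ℝ (Fin 3))) + A (a + b)) - v p‖ ^ 2 ≤
            2 * ‖v ((p : (EuclideanSpace ℝ (Fin 3))) + A a + A b) - v (p + A a)‖ ^ 2 + 2 * ‖v ((p : (EuclideanSpace ℝ (Fin 3))) + A a) - v p‖ ^ 2 := by
          intro p _
          have hsplit : v ((p : (EuclideanSpace ℝ (Fin 3))) + A (a + b)) - v p =
              (v ((p : (EuclideanSpace ℝ (Fin 3))) + A a + A b) - v (p + A a)) + (v ((p : (EuclideanSpace ℝ (Fin 3))) + A a) - v p) := by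
            rw [map_add, add_assoc]; abel
          rw [hsplit]
          exact norm_add_sq_le_two _ _
        calc ∑ p ∈ U, ‖v ((p : (EuclideanSpace ℝ (Fin 3))) + A (a + b)) - v p‖ ^ 2
            ≤ ∑ p ∈ U, (2 * ‖v ((p : (EuclideanSpace ℝ (Fin 3))) + A a + A b) - v (p + A a)‖ ^ 2 +
                2 * ‖v ((p : (EuclideanSpace ℝ (Fin 3))) + A a) - v p‖ ^ 2) := Finset.sum_le_sum hpt
          _ = 2 * ∑ p ∈ U, ‖v ((p : (EuclideanSpace ℝ (Fin 3))) + A a + A b) - v (p + A a)‖ ^ 2 +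
                2 * ∑ p ∈ U, ‖v ((p : (EuclideanSpace ℝ (Fin 3))) + A a) - v p‖ ^ 2 := by
              rw [Finset.sum_add_distrib, Finset.mul_sum, Finset.mul_sum]
          _ ≤ 2 * (Cb * R) + 2 * (Ca * R) := by gcongr
          _ = (2 * Cb + 2 * Ca) * R := by ring
      zero_mem' := ⟨zero_mem_Λ₀, 0, fun c R hR U hU => by simp⟩
      neg_mem' := by
        rintro a ⟨ha, Ca, hCa⟩
        have hneg : (0 : (EuclideanSpace ℝ (Fin 3))) - a ∈ Λ₀ := hcpLiouvilleLam_sub_mem zero_mem_Λ₀ ha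
        rw [zero_sub] at hneg
        refine ⟨hneg, Ca, fun c R hR U hU => ?_⟩
        let emb : Sites₀ t A ↪ Sites₀ t A :=
          ⟨fun p => ⟨p - A a, sub_mem_sites₀'' p.2 ha⟩, fun x y h => Subtype.ext (sub_left_injective
            (congrArg Subtype.val h))⟩
        have hU' : ∀ p ∈ U.map emb, dist (p : (EuclideanSpace ℝ (Fin 3))) (c - A a) ≤ R := by
          intro p hp
          rw [Finset.mem_map] at hp
          obtain ⟨p₀, hp₀, rfl⟩ := hp
          show dist ((p₀ : (EuclideanSpace ℝ (Fin 3))) - A a) (c - A a) ≤ R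
          rw [dist_sub_right]
          exact hU p₀ hp₀
        have h := hCa (c - A a) R hR (U.map emb) hU'
        rw [Finset.sum_map] at h
        refine le_trans (le_of_eq (Finset.sum_congr rfl fun p _ => ?_)) h
        show ‖v ((p : (EuclideanSpace ℝ (Fin 3))) + A (-a)) - v p‖ ^ 2 = ‖v ((p : (EuclideanSpace ℝ (Fin 3))) - A a + A a) - v (p - A a)‖ ^ 2
        rw [map_neg, ← sub_eq_add_neg, sub_add_cancel, ← norm_neg, neg_sub] }
  -- the three generators belong to it
  have hc : (layerNormal (2 * Real.sqrt (2 / 3)) : (EuclideanSpace ℝ (Fin 3))) ∈ Λ₀ := ⟨0, 0, 1, by simp⟩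
  have hv₂ : (triangularVec₂ 1 : (EuclideanSpace ℝ (Fin 3))) ∈ Λ₀ := ⟨0, 1, 0, by simp⟩
  have h1 : (triangularVec₁ 1 : (EuclideanSpace ℝ (Fin 3))) ∈ G := by
    obtain ⟨hAe, hmid⟩ := mid_of_norm_eq_one (t := t) hA norm_triangularVec₁
    exact ⟨triangularVec₁_mem_Λ₀, path_of_twoStep hA hI hG triangularVec₁_mem_Λ₀ hAe hmid⟩
  have h2 : (triangularVec₂ 1 : (EuclideanSpace ℝ (Fin 3))) ∈ G := by
    obtain ⟨hAe, hmid⟩ := mid_of_norm_eq_one (t := t) hA norm_triangularVec₂'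
    exact ⟨hv₂, path_of_twoStep hA hI hG hv₂ hAe hmid⟩
  have h3 : (layerNormal (2 * Real.sqrt (2 / 3)) : (EuclideanSpace ℝ (Fin 3))) ∈ G :=
    ⟨hc, path_of_twoStep hA hI hG hc (norm_apply_layerPeriod_le hA) (mid_layerPeriod hA hI)⟩
  have hzG : z ∈ G := by
    obtain ⟨i, j, k, rfl⟩ := hz
    rw [Int.cast_smul_eq_zsmul ℝ i, Int.cast_smul_eq_zsmul ℝ j, Int.cast_smul_eq_zsmul ℝ k]
    exact G.add_mem (G.add_mem (G.zsmul_mem h1 i) (G.zsmul_mem h2 j)) (G.zsmul_mem h3 k)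
  exact hzG.2

/-- Registered form of `flatDiff_pathBound_of_growthBound` (sub-goal of crux stmt-AtomisticToContinuum-9332, line
`Sketch`): the path bound for the period differences of a field with the growth bound. [folklore] -/
theorem hcpLiouville_pathBound : ∀ (t : Fin 2 → (EuclideanSpace ℝ (Fin 3))) (A : (EuclideanSpace ℝ (Fin 3)) →L[ℝ] (EuclideanSpace ℝ (Fin 3))) (v : (EuclideanSpace ℝ (Fin 3)) → (EuclideanSpace ℝ (Fin 3))), Adm₀ A → Inner₀ t A → GrowthBound t A v → ∀ z ∈ Λ₀, ∃ C : ℝ, ∀ (c : (EuclideanSpace ℝ (Fin 3))) (R : ℝ), 1 ≤ R → ∀ U : Finset (Sites₀ t A), (∀ p ∈ U, dist (p : (EuclideanSpace ℝ (Fin 3))) c ≤ R) → ∑ p ∈ U, ‖v (p + A z) - v p‖ ^ 2 ≤ C * R := by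
  intro t A v hA hI hG z hz
  exact flatDiff_pathBound_of_growthBound hA hI hG hz

end Summit.AtomisticToContinuum.Crystallization.Theorems.ExcessDecayLiouville

end
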